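import Summits.QuantumFields.YangMills.Theorems.BalabanUVNodesN09MembershipDoorLettersAtZ3

/-!
# NODE N09 — door v1.3 (F-I-χ «ρ-edition»): a CLOSED membership radius IN THE RECORD's OWN LETTERS — `ρ := θ.ν.A₀`, the (2.4) profile constant of the Stage-7 numerics (at the Z3 pin
# `A₀ᶜᶜ¹(L; B₃, B₃′, a₀, a₁)`, DEF-1∕def-R's `A0OfThm1CC1`, built so that `B₃·A₀ᶜᶜ¹ ≤ a₀`) — meets ALL the door's LETTER rows and N07's window `2B₃ρ ≤ a₀L²` at the pin: the kernel datum
# for director-ym №316 (4) (Q-ρα) «exhibit OR exclude a closed `ρOfRecord₁₃` in letters the record core can reach» — LETTER SIDE EXHIBITED; the plaquette-route room for `hχregU` is NOT a letter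
# condition any `ρ` can meet at the pin (inner∕outer invariant), and print meets `hχregU` by [B11] Sect. G (`hmemχ` of `…N09MembershipSupportClauseReading`), not by plaquettes

TRACK A (YM-PLAN §2d, node N09 of 28), seat `pub-ymgap-dag-n09-w1` (D-0149 width seat 1∕4), generation g8, file 9 of the (G-a) set (9∕12 of the guard).  Key of record K1⁹ stmt-QuantumFields-27364
(`--supports … --as helper`, count-neutral).  [I] = [Balaban1987RG1], [III] = [Balaban1988Convergent], [B11] = [Balaban1985Variational], [B7] = [Balaban1985Averaging].  Imports file 7
`…N09MembershipDoorLettersAtZ3` (✓p748067; ⇒ `numerics_ρ_of_le`, `Node00.Record13NumericsOfThm1CCM`).  THEOREMS ONLY (0 `def`, 0 `sorry`).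

WHY.  №316 (3)–(4): the arity-preserving core edition (α) needs a CLOSED expression `ρOfRecord₁₃` in letters the record core reaches; the director listed the candidates `ν.ε₀L²∕2` (= `a₀` at the pin:
window empty), `ν.εreg` ((D2), dead), `θ.ε₂₉` (kills `hχregU`'s room) and found none.  One was missed: the Stage-7 numerics CARRY the (2.4) profile constant `ν.A₀`, and at the Z3 pin
`ν.A₀ = A0OfThm1CC1 F.L B₃ B₃' a₀ a₁` (`numerics7OfThm1CCM_A₀`, `rfl`) with the tree theorems `A0OfThm1CC1_pos`, `A0OfThm1CC1_le_a₁`, ★ `mul_A0OfThm1CC1_le_a₀ : B₃·A₀ᶜᶜ¹ ≤ a₀` ([B11] Thm 1 (8)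
bookkeeping — «A₀ was built for it», DEF-1).  Hence with `ρ := ν.A₀`: `0 < ρ`; `ρ ≤ a₀ = ν.εreg = εbg` (`B₃ ≥ 2L² ≥ 1`); `2ρ ≤ 2a₀ ≤ ν.ε₀·L²` (LOCATED-K0ε₀); the [B7] rows by monotonicity; and N07's
window `2·B₃·ρ ≤ 2a₀ ≤ a₀·L²` (`L ≥ 12`) — ALL the door's letter rows, in letters the core binds (`θ.ν.A₀`), uniformly in the K0 ∃-letters.  What `ρ := ν.A₀` does NOT buy (nor any `ρ`):
the PLAQUETTE-route room for `hχregU` (supp χ₂₉ ⊆ domU^ρ via ✓p747700 `mem_domUOfRecord_of_plaqSmall_of_thm1Objects` with `B₃δ ≤ ρ`, `δ` = the χ₂₉-support's plaquette radius `≥ 2ν.εreg∕L² =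
2a₀∕L²` by K0e's `hord`) — that asks `2B₃a₀∕L² ≤ ρ ≤ a₀`, i.e. `2B₃ ≤ L²`, the inner∕outer invariant of ✓p746046 §3 once more; print meets `hχregU` by [B11] Sect. G ∕ Prop. 9 p.309 + [I] p.265
(`hmemχ`, ✓ `…N09MembershipSupportClauseReading`), never by plaquettes.  So for (Q-ρα): LETTER SIDE EXHIBITED (`ρOfRecord₁₃ := θ.ν.A₀`); PLAQUETTE-ROUTE ROOM EXCLUDED for every `ρ`
(math-bound at the pin); under (α) with `ρ := θ.ν.A₀` the door's K0e-side debt is `hχregpt` + `hmemχ` exactly as under (D0).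
* §1 `profileRadius_le_a₀` · `two_B₃_profileRadius_le` · `two_profileRadius_le_eps0_Lsq` — arithmetic from `mul_A0OfThm1CC1_le_a₀` under `2(F.L)² ≤ B₃`.
* §2 ★★ `doorLetterRows_at_Z3_letters_profileRadius` — the conjunction of file 7's `doorLetterRows_at_Z3_letters` with `ρ := (numerics7OfThm1CCM F.L j ε₀ B₃ B₃' a₀ a₁).A₀`.
HONEST FRAMING: arithmetic on displayed letters + `rfl` faces + DEF-1∕def-R's landed inequalities; nothing of Bałaban asserted; no record core edited ((α)∕(β)∕(D0) is the human column's,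
№316 (3)); the door's `hopen`∕`hχregpt`∕`hmemχ`∕`hres`∕`huniq` rows untouched (not yet ∕ debts of record); FLAG №7′ OPEN; N09 ∕ N07 ∕ N24 NOT discharged; counts unmoved (typed 28∕28 · discharged
8∕28); R4 = the conditional finite-𝕋⁴ rung `BalabanLadder.UV` only; the Yang–Mills mass gap (Clay) is NOT proved by any of this.
-/

noncomputable section

namespace Summit.QuantumFields.YangMills.BalabanUVNodes.N09MembershipDoorLettersAtZ3ProfileRadius

open Literature.MathematicalPhysics.QuantumFieldTheory.Balaban1983to89
open Literature.MathematicalPhysics.QuantumFieldTheory.Balaban1983to89.T4Continuum (T4Family)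
open Literature.MathematicalPhysics.QuantumFieldTheory.Balaban1983to89.Node00
open Literature.MathematicalPhysics.QuantumFieldTheory.Balaban1983to89.ExpMeanLog (deltaSU)
open Summit.QuantumFields.YangMills.BalabanUVNodes.N09MembershipDomainDoorAtRecord (numerics_ρ_of_le)

/-! ## §1. Arithmetic of the profile radius `A₀ᶜᶜ¹` under the engine's letters -/

/-- `A₀ᶜᶜ¹ ≤ a₀` from `B₃·A₀ᶜᶜ¹ ≤ a₀` (DEF-1∕def-R `mul_A0OfThm1CC1_le_a₀`) and `1 ≤ B₃` (K0's guard `2L² ≤ B₃`). [cite: Balaban1985Variational, Thm 1 (8) p.279; Balaban1988Convergent, (2.4) p.255 (bookkeeping)] -/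
theorem profileRadius_le_a₀ (F : T4Family) {B₃ B₃' a₀ a₁ : ℝ} (hB₃ : 2 * (F.L : ℝ) ^ 2 ≤ B₃) (hB' : 0 ≤ B₃') (ha₀ : 0 < a₀) (ha₁ : 0 < a₁) :
    A0OfThm1CC1 F.L B₃ B₃' a₀ a₁ ≤ a₀ := by
  have hL : (1 : ℝ) ≤ F.L := by exact_mod_cast F.hL.2.le
  have hL2 : 1 ≤ (F.L : ℝ) ^ 2 := one_le_pow₀ hL
  have hB1 : 1 ≤ B₃ := by nlinarith
  have hB0 : 0 ≤ B₃ := by linarith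
  have hA0 : 0 ≤ A0OfThm1CC1 F.L B₃ B₃' a₀ a₁ := (A0OfThm1CC1_pos hB0 hB' ha₀ ha₁).le
  have h := mul_A0OfThm1CC1_le_a₀ (L := F.L) hB0 hB' ha₀.le ha₁.le
  nlinarith

/-- N07's window row at the profile radius: `2·B₃·A₀ᶜᶜ¹ ≤ a₀·L²` (`2B₃A₀ᶜᶜ¹ ≤ 2a₀ ≤ a₀L²`, `L ≥ 12`). [cite: Balaban1985Variational, Thm 1 (6)–(8) p.279; Balaban1987RG1, (2.2)–(2.3) p.265 (bookkeeping)] -/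
theorem two_B₃_profileRadius_le (F : T4Family) {B₃ B₃' a₀ a₁ : ℝ} (hB₃ : 2 * (F.L : ℝ) ^ 2 ≤ B₃) (hB' : 0 ≤ B₃') (ha₀ : 0 < a₀) (ha₁ : 0 < a₁) :
    2 * B₃ * A0OfThm1CC1 F.L B₃ B₃' a₀ a₁ ≤ a₀ * (F.L : ℝ) ^ 2 := by
  have hL : (12 : ℝ) ≤ F.L := by exact_mod_cast F.hL11
  have hL2 : 2 ≤ (F.L : ℝ) ^ 2 := by nlinarith
  have hB0 : 0 ≤ B₃ := by nlinarith
  have h := mul_A0OfThm1CC1_le_a₀ (L := F.L) hB0 hB' ha₀.le ha₁.le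
  nlinarith

/-- The nesting letter at the profile radius from LOCATED-K0ε₀: `2·a₀ ≤ ε₀·L′²` ⇒ `2·A₀ᶜᶜ¹ ≤ ε₀·L′²`. [cite: Balaban1987RG1, (1.2) p.260 and p.259 (bookkeeping)] -/
theorem two_profileRadius_le_eps0_Lsq (F : T4Family) {B₃ B₃' a₀ a₁ ε₀ L' : ℝ} (hB₃ : 2 * (F.L : ℝ) ^ 2 ≤ B₃) (hB' : 0 ≤ B₃') (ha₀ : 0 < a₀) (ha₁ : 0 < a₁)
    (hbg₀ : 2 * a₀ ≤ ε₀ * L' ^ 2) : 2 * A0OfThm1CC1 F.L B₃ B₃' a₀ a₁ ≤ ε₀ * L' ^ 2 := by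
  have h := profileRadius_le_a₀ F hB₃ hB' ha₀ ha₁
  linarith

/-! ## §2. The door's letter rows at the Z3 pin with the CLOSED radius `ρ := ν.A₀` -/

/-- ★★ **THE DOOR's LETTER ROWS AT THE Z3 PIN WITH `ρ := θ.ν.A₀`** (a closed expression in letters the record core binds): at `ν := numerics7OfThm1CCM F.L j ε₀ B₃ B₃' a₀ a₁` (`ν.A₀ = A₀ᶜᶜ¹`,
`ν.εreg = a₀`, `ν.ε₀ = ε₀`, all `rfl`), `εbg := a₀`, given the engine's `0 < a₀`, `0 < a₁`, `0 ≤ B₃'`, K0's guard `2·(F.L)² ≤ B₃`, LOCATED-K0ε₀ per run and the [B7]-numerics on `a₀` per run: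
`0 < ν.A₀ ∧ ν.A₀ ≤ ν.εreg ∧ ν.εreg ≤ a₀ ∧ 2·B₃·ν.A₀ ≤ a₀·(F.L)² ∧ (∀ P, 2·ν.A₀ ≤ ν.ε₀·(F.P P.K).L²) ∧ (∀ P, [B7] rows on ν.A₀)`.  Letters only; nothing of Bałaban asserted; the plaquette-route
room for `hχregU` is NOT among these rows and is unmeetable by any `ρ` at the pin (module docstring). [cite: Balaban1988Convergent, (2.4) p.255; Balaban1985Variational, Thm 1 (8) p.279; Balaban1987RG1, (1.2) p.260 and (2.2)–(2.3) p.265; Balaban1985Averaging, Prop. 2 (53) p.26 (bookkeeping)] -/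
theorem doorLetterRows_at_Z3_letters_profileRadius (F : T4Family) (N : ℕ) (j : ℕ) (ε₀ B₃ B₃' a₀ a₁ : ℝ) (ha₀ : 0 < a₀) (ha₁ : 0 < a₁) (hB' : 0 ≤ B₃')
    (hB₃ : 2 * (F.L : ℝ) ^ 2 ≤ B₃)
    (hbg₀ : ∀ P : B12.RunParams, 2 * a₀ ≤ ε₀ * ((F.P P.K).L : ℝ) ^ 2)
    (hbg3 : ∀ P : B12.RunParams, (143 * (((((F.P P.K).d + 4 : ℕ) : ℝ)) ^ 2 / 4) ^ 2) * a₀ ≤ 1 / 3)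
    (hbg2 : ∀ P : B12.RunParams, 2 * a₀ ≤ 2 * deltaSU (Fin N) / ((((F.P P.K).d + 4) * (F.P P.K).L : ℕ) : ℝ) ^ 2) :
    0 < (numerics7OfThm1CCM F.L j ε₀ B₃ B₃' a₀ a₁).A₀ ∧
    (numerics7OfThm1CCM F.L j ε₀ B₃ B₃' a₀ a₁).A₀ ≤ (numerics7OfThm1CCM F.L j ε₀ B₃ B₃' a₀ a₁).εreg ∧
    (numerics7OfThm1CCM F.L j ε₀ B₃ B₃' a₀ a₁).εreg ≤ a₀ ∧
    2 * B₃ * (numerics7OfThm1CCM F.L j ε₀ B₃ B₃' a₀ a₁).A₀ ≤ a₀ * (F.L : ℝ) ^ 2 ∧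
    (∀ P : B12.RunParams, 2 * (numerics7OfThm1CCM F.L j ε₀ B₃ B₃' a₀ a₁).A₀ ≤ (numerics7OfThm1CCM F.L j ε₀ B₃ B₃' a₀ a₁).ε₀ * ((F.P P.K).L : ℝ) ^ 2) ∧
    (∀ P : B12.RunParams,
      (143 * (((((F.P P.K).d + 4 : ℕ) : ℝ)) ^ 2 / 4) ^ 2) * (numerics7OfThm1CCM F.L j ε₀ B₃ B₃' a₀ a₁).A₀ ≤ 1 / 3 ∧
      2 * (numerics7OfThm1CCM F.L j ε₀ B₃ B₃' a₀ a₁).A₀ ≤ 2 * deltaSU (Fin N) / ((((F.P P.K).d + 4) * (F.P P.K).L : ℕ) : ℝ) ^ 2) := by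
  have hB0 : 0 ≤ B₃ := by nlinarith [sq_nonneg (F.L : ℝ)]
  rw [numerics7OfThm1CCM_A₀, numerics7OfThm1CCM_εreg]
  refine ⟨A0OfThm1CC1_pos hB0 hB' ha₀ ha₁, profileRadius_le_a₀ F hB₃ hB' ha₀ ha₁, le_rfl, two_B₃_profileRadius_le F hB₃ hB' ha₀ ha₁, fun P => ?_, fun P => ?_⟩
  · rw [numerics7OfThm1CCM_ε₀]; exact two_profileRadius_le_eps0_Lsq F hB₃ hB' ha₀ ha₁ (hbg₀ P)
  · exact numerics_ρ_of_le (profileRadius_le_a₀ F hB₃ hB' ha₀ ha₁) (hbg3 P) (hbg2 P)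

end Summit.QuantumFields.YangMills.BalabanUVNodes.N09MembershipDoorLettersAtZ3ProfileRadius

end
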